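import Summits.BirchSwinnertonDyer.BirchSwinnertonDyer.Theses.VerticalHeegnerOrder
import Literature.NumberTheory.EllipticCurves.ModularityVersionApProofs

/-!
# Birth skeleton (BC3) for crux `VerticalExactOrder` — item stmt-BirchSwinnertonDyer-18466, route VerticalHeegnerOrder

Registered by the skeleton-registrar seat `planner-skel-stmt-BirchSwinnertonDyer-18466-0` (2026-08-17).
Published as `Cruxes/VerticalExactOrder/Lines/birth.lean`; card `Lines/birth.md`.

The crux X1 (level-one vertical exact order): for every global minimal non-CM `W/ℚ` with `2 ≤ r_an(W)` and
every BALANCED Heegner imaginary quadratic `K` (`d_K < -4`, embedding `ι`) there is ONE admissible prime `p`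
(`p ≥ 5` good ordinary, `ρ̄_{W,p}` onto, `p ∤ d_K h_K`, `max(r_an W, r_an W^K) ≤ p`, plus an admissible global
minimal model of the twist `W^{d_K}`) and Heegner data `(Dt, β, y, H, σ)` of conductor `p²` such that the
divided derivative `D^{(j)}P₁`, `P₁ = Σ_{τ∈H} τy`, `j = max − 1`, is NOT in `p·E(K[p²])^H + E(K[p²])_tors`.

## The cut (three composition stubs + one BC5 rung stub; `VerticalExactOrder_of` proved)

* `stub_admissiblePairCofinite` (M/L, true in print, provable from the tree) — ADMISSIBILITY IS COFINITE IN `p`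
  FOR THE PAIR `(W, W^d)` GIVEN ORDINARITY: for non-CM `W` and `d ≠ 0` there is `B` such that every good
  ordinary prime `p ≥ B` of `W` has `ρ̄_{W,p}` onto AND the twist `W^d` has a global minimal model that is good,
  ordinary and big-image at `p`.  Serre's open image theorem for `W` and for the (non-CM,
  `not_hasCM_quadraticTwist`) twist (`serre_open_image_holds`), good reduction of the twist off its minimal
  discriminant (`hasGoodReductionAtPrime_of_not_dvd`), the twisting formula `a_p(W^d) = (d₀/p)·a_p(W)`
  (`frobeniusTrace_quadraticTwist_holds`, `d = d₀e²`, `exists_variableChange_quadraticTwist_mul_sq`),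
  `hasGlobalMinimalModel_rat_holds`.  This is where the crux's four bookkeeping admissibility clauses live.
* `stub_heegnerLift` (L/XL, CM theory — the refuter-flagged prover-blocking gap "KolyvaginHeegnerData.y is DATA")
  — `y(n) ∈ E(K[n])`: for `K` imaginary quadratic Heegner for `N = N_W`, any parametrisation datum `Dt` of level
  `N`, any orientation `β² ≡ d_K (mod 4N)` and any conductor `n ≥ 1` prime to `N`, the complex Heegner point
  `φ(x(n))` lifts to `E(K[n])` along `K[n] ⊂ ℂ` (Gross 1991 §3 "the theory of complex multiplication shows that
  `x_n` is rational over `K_n`"; Shimura reciprocity for `X₀(N)`; `φ` is `ℚ`-rational: every `Dt.φ` is an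
  integer multiple of the minimal-Manin-constant parametrisation, an isogeny `E_f → E` over `ℚ`).  Stated for
  general `n` so that it also serves every `KolyvaginHeegnerData` consumer.
* `stub_levelOneNondivisibilityIO` (OPEN — the heart; BD Conj. 3.10 upper half at the first layer, at
  unboundedly many primes) — for `W, K` as in the crux and EVERY bound `B` there is a good ordinary prime `p ≥ B`
  with a parametrisation `Dt`, an orientation `β`, an index-`p` normal `H ≤ Gal(K[p²]/K)` and `σ ∉ H` such that
  for EVERY `K[p²]`-rational lift `y` of `φ(x(p²))` (unique when it exists; it exists by `stub_heegnerLift`) the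
  level-one test passes at `j = max(r_an W, r_an W^K) − 1`.  Versus the crux: the admissibility bookkeeping
  (`p ≥ 5`, `ρ̄` onto, `p ∤ d_K h_K`, `max ≤ p`, twist model) is REMOVED (it is cofinite, stub 1) and "∃ one
  prime" becomes "unboundedly many" — the form every density / non-vanishing-in-the-tower argument delivers
  (Cornut–Vatsal type), and what lets the glue dodge the finitely many inadmissible primes.  NOT the refuted-looking
  "∀ admissible p" strengthening of the previous skeleton (`stub_levelOne_test_at_admissible`): the 2001 programme
  records a level-one FAILURE at an admissible prime ((389a1, ℚ(√−7), 5), Thm L: `k = 1` decided only at level 2;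
  Mazur–Tate degeneracy scans predict failure rates 13/273 at `p = 5`), so "every admissible p" is plausibly
  false while "infinitely many p" is the honest strengthening (failure probability `≍ 1/p`).
* `stub_rung_cert389a1d11p5` (BC5 plan-only rung, NOT a hypothesis of the composition) — the crux's own
  instance `W = 389a1 = [0,1,1,-2,0]`, `d_K = -11`, pinned to `p = 5` (`j = 1`): the 2001 level-one certificate
  (Thm D) in the typed normalisation; outside BSD's known regime (`r_an = 2`).  Technique: certified numerics
  (complex Heegner point of conductor 25 on X₀(389), trace to `K₁`, `D^{(1)} = Σ i σ^i`, 5-divisibility in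
  `E(K₁)` via reduction / height bounds) — a `kit compute` job plus algebraic-number recognition.

`VerticalExactOrder_of` (sorry-free): given `W, K, ι`, take `B₁` from stub 1 for `d = d_K`, call stub 3 with
`B = B₁ + 5 + |d_K| + h_K + r_an(W) + r_an(W^K)`; the returned good ordinary `p ≥ B` is then admissible
(`ρ̄` onto and the twist model from stub 1; `p ∤ d_K`, `p ∤ h_K`, `max ≤ p`, `5 ≤ p` by size), `p ∤ N_W`
(`dvd_conductorNorm_iff_not_hasGoodReductionAtPrime`) so stub 2 lifts `φ(x(p²))` to `y ∈ E(K[p²])`, and stub 3's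
test clause at that `y` is the crux's conclusion.

## Disproof used
No `Cruxes/VerticalExactOrder/Disproof.lean` exists yet (`ledger crux ls`: no workfiles before this one); the
refuter's birth attack (item evidence ATTACK.md, 2026-08-17) is honoured: (i) its "∀-large-p strengthening
plausibly false" is why the heart is the IO form, not the cofinite/∀ form; (ii) its "y ↦ p•y kills the test,
Manin c ∈ c_min ℤ" is why `Dt` stays EXISTENTIAL in the heart (a `∀ Dt` form is false: `Dt` with `p ∣ c/c_min`
exist) while `y` may be UNIVERSAL (the lift is unique); (iii) its "KolyvaginHeegnerData.y is DATA, CM rationality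
not in tree — prover-blocking" is exactly `stub_heegnerLift`; (iv) negatives index: stmt-15532 (CM TamePinch) is
not touched (`¬ W.HasCM` kept in stubs 1 and 3).
-/

namespace Summit.BirchSwinnertonDyer.BirchSwinnertonDyer.Cruxes.VerticalExactOrder.Birth

open scoped BigOperators Classical
open Literature Literature.NumberTheory.EllipticCurves Literature.NumberTheory.EllipticCurves.ModularForms
open Summit.BirchSwinnertonDyer.BirchSwinnertonDyer.Theses.VerticalHeegnerOrder

set_option linter.dupNamespace false

/-- **Stub 1 (M/L; true in print): admissibility is cofinite in `p` for the pair `(W, W^d)` given ordinarity.**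
For a non-CM elliptic `W/ℚ` (global minimal) and `d ≠ 0` there is `B` such that for every prime `p ≥ B` of good
ordinary reduction for `W`: `ρ̄_{W,p}` is surjective, and some global minimal model `C • W^d` of the quadratic
twist has good ordinary reduction at `p` with `ρ̄` surjective.  Serre 1972 §4.2 Thm 2 for `W` and for the non-CM
twist (`serre_open_image_holds`, `not_hasCM_quadraticTwist`), `a_p(W^d) = (d₀/p) a_p(W)` for `p ∤ 2d`
(`frobeniusTrace_quadraticTwist_holds`), good reduction off the minimal discriminant, `hasGlobalMinimalModel_rat_holds`. -/
theorem stub_admissiblePairCofinite :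
    ∀ (W : WeierstrassCurve ℚ) [W.IsElliptic] [W.IsGloballyMinimal], ¬ W.HasCM → ∀ (d : ℤ), d ≠ 0 → ∃ B : ℕ, ∀ (p : ℕ) [Fact p.Prime], B ≤ p → W.HasGoodReductionAtPrime p → ¬ (p : ℤ) ∣ W.frobeniusTrace p → W.HasSurjectiveModNGaloisRep p ∧ ∃ (C : WeierstrassCurve.VariableChange ℚ) (_ : (C • W.quadraticTwist (d : ℚ)).IsGloballyMinimal), (C • W.quadraticTwist (d : ℚ)).HasGoodReductionAtPrime p ∧ ¬ (p : ℤ) ∣ (C • W.quadraticTwist (d : ℚ)).frobeniusTrace p ∧ (C • W.quadraticTwist (d : ℚ)).HasSurjectiveModNGaloisRep p := by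
  sorry

/-- **Stub 2 (L/XL; CM theory): the Heegner point of conductor `n` is rational over the ring class field `K[n]`.**
For `W/ℚ` elliptic, `K` imaginary quadratic satisfying the Heegner hypothesis for `N = N_W`, a parametrisation
datum `Dt` of level `N`, an orientation `β` with `β² ≡ d_K (mod 4N)` and `n ≥ 1` prime to `N`, the complex point
`y(n) = φ(x(n)) ∈ E(ℂ)` is the image of a point of `E(K[n])` under `K[n] ⊂ ℂ` (Gross 1991 §3: "the theory of
complex multiplication shows that the point `x_n` is rational over `K_n`"; `φ : X₀(N) → E` is defined over `ℚ` —
every `Dt.φ` is `[m] ∘ φ_min`).  This is the existence half of `KolyvaginHeegnerData.y / map_y`, DATA in the tree. -/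
theorem stub_heegnerLift :
    ∀ (W : WeierstrassCurve ℚ) [W.IsElliptic] [NeZero (W.conductorNorm ℤ)] (K : Type) [Field K] [NumberField K] (ι : K →+* ℂ), Literature.NumberTheory.EllipticCurves.IsImaginaryQuadratic K → Literature.NumberTheory.EllipticCurves.SatisfiesHeegnerHypothesis (W.conductorNorm ℤ) K → ∀ (Dt : Literature.NumberTheory.EllipticCurves.ModularForms.ModularParametrizationData W (W.conductorNorm ℤ)) (β : ℤ), (4 * (W.conductorNorm ℤ : ℤ)) ∣ β ^ 2 - NumberField.discr K → ∀ (n : ℕ), n ≠ 0 → Nat.Coprime n (W.conductorNorm ℤ) → ∃ y : (W.baseChange (Literature.NumberTheory.EllipticCurves.ringClassField K ι n)).toAffine.Point, WeierstrassCurve.Affine.Point.map (Literature.NumberTheory.EllipticCurves.ringClassField K ι n).subtype.toRatAlgHom y = Literature.NumberTheory.EllipticCurves.ModularForms.heegnerPointComplexOfConductor Dt (NumberField.discr K) β n := by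
  sorry

/-- **Stub 3 (OPEN — the heart): level-one non-divisibility of the divided-derivative Heegner trace at
unboundedly many good ordinary primes.**  For `W` global minimal non-CM with `2 ≤ r_an(W)`, `K` imaginary
quadratic Heegner for `N_W` with `d_K < -4` and balanced, and every `B`, there are a prime `p ≥ B` of good
ordinary reduction, a parametrisation `Dt`, an orientation `β`, an index-`p` normal subgroup `H ≤ Gal(K[p²]/K)`
and `σ ∈ Gal(K[p²]/K) ∖ H` such that for every lift `y ∈ E(K[p²])` of `φ(x(p²))` the point
`Σ_{i<p} C(i, j) σ^i (Σ_{τ∈H} τ y)`, `j = max(r_an W, r_an W^K) − 1`, is not `p·Q + T` with `Q` `H`-invariant and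
`T` torsion.  (BD Conj. 3.10 upper half in first-layer form at infinitely many primes; the crux asks for one
ADMISSIBLE such prime — admissibility is cofinite, stub 1.) -/
theorem stub_levelOneNondivisibilityIO :
    ∀ (W : WeierstrassCurve ℚ) [W.IsElliptic] [W.IsGloballyMinimal], ¬ W.HasCM → 2 ≤ W.analyticRank → ∀ (K : Type) [Field K] [NumberField K] (ι : K →+* ℂ), Literature.NumberTheory.EllipticCurves.IsImaginaryQuadratic K → Literature.NumberTheory.EllipticCurves.SatisfiesHeegnerHypothesis (W.conductorNorm ℤ) K → NumberField.discr K < -4 → ((W.quadraticTwist (NumberField.discr K : ℚ)).analyticRank + 1 = W.analyticRank ∨ (W.quadraticTwist (NumberField.discr K : ℚ)).analyticRank = W.analyticRank + 1) → ∀ B : ℕ, ∃ (p : ℕ) (_ : Fact p.Prime), B ≤ p ∧ W.HasGoodReductionAtPrime p ∧ ¬ (p : ℤ) ∣ W.frobeniusTrace p ∧ ∃ (_ : NeZero (W.conductorNorm ℤ)) (Dt : Literature.NumberTheory.EllipticCurves.ModularForms.ModularParametrizationData W (W.conductorNorm ℤ)) (β : ℤ) (H : Subgroup (Literature.NumberTheory.EllipticCurves.ringClassField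 K ι (p ^ 2) ≃ₐ[ℚ] Literature.NumberTheory.EllipticCurves.ringClassField K ι (p ^ 2))) (σ : Literature.NumberTheory.EllipticCurves.ringClassField K ι (p ^ 2) ≃ₐ[ℚ] Literature.NumberTheory.EllipticCurves.ringClassField K ι (p ^ 2)), (4 * (W.conductorNorm ℤ : ℤ)) ∣ β ^ 2 - NumberField.discr K ∧ H ≤ Literature.NumberTheory.EllipticCurves.ringClassGal ι (p ^ 2) ∧ H.relIndex (Literature.NumberTheory.EllipticCurves.ringClassGal ι (p ^ 2)) = p ∧ (∀ g ∈ Literature.NumberTheory.EllipticCurves.ringClassGal ι (p ^ 2), ∀ h ∈ H, g * h * g⁻¹ ∈ H) ∧ σ ∈ Literature.NumberTheory.EllipticCurves.ringClassGal ι (p ^ 2) ∧ σ ∉ H ∧ ∀ (y : (W.baseChange (Literature.NumberTheory.EllipticCurves.ringClassField K ι (p ^ 2))).toAffine.Point), WeierstrassCurve.Affine.Point.map (Literature.NumberTheory.EllipticCurves.ringClassField K ι (p ^ 2)).subtype.toRatAlgHom y = Literature.NumberTheory.EllipticCurves.ModularForms.heegnerPointComplexOfConductor Dt (NumberField.discr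 K) β (p ^ 2) → ¬ ∃ (Q T : (W.baseChange (Literature.NumberTheory.EllipticCurves.ringClassField K ι (p ^ 2))).toAffine.Point), IsOfFinAddOrder T ∧ (∀ τ ∈ H, Literature.NumberTheory.EllipticCurves.pointGalHom W (Literature.NumberTheory.EllipticCurves.ringClassField K ι (p ^ 2)) τ Q = Q) ∧ (∑ i ∈ Finset.range p, Nat.choose i (max W.analyticRank (W.quadraticTwist (NumberField.discr K : ℚ)).analyticRank - 1) • Literature.NumberTheory.EllipticCurves.pointGalHom W (Literature.NumberTheory.EllipticCurves.ringClassField K ι (p ^ 2)) (σ ^ i) (∑ᶠ τ ∈ (H : Set (Literature.NumberTheory.EllipticCurves.ringClassField K ι (p ^ 2) ≃ₐ[ℚ] Literature.NumberTheory.EllipticCurves.ringClassField K ι (p ^ 2))), Literature.NumberTheory.EllipticCurves.pointGalHom W (Literature.NumberTheory.EllipticCurves.ringClassField K ι (p ^ 2)) τ y)) = p • Q + T := by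
  sorry

/-- **Stub 4 (BC5 plan-only rung; not a hypothesis of the composition): the crux's own instance
`(389a1, ℚ(√−11))` pinned to `p = 5`.**  For `W = [0,1,1,-2,0]` (389a1, global minimal, `r_an = 2`) and `K`
imaginary quadratic of discriminant `-11` (Heegner for 389, `r_an(W^{-11}) = 1`: balanced, `j = 1`), the crux's
conclusion holds with `p = 5` (good ordinary: `a_5 = -3`; `ρ̄_5` onto; `5 ∤ 11·h_K`, `h_K = 1`): the 2001 level-one
certificate (Thm D) `D^{(1)}P₁ = Σ_{i<5} i σ^i P₁ ∉ 5·E(K[25])^H + tors`, to be re-certified in the typed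
normalisation (certified numerics; outside BSD's known regime since `r_an = 2`). -/
theorem stub_rung_cert389a1d11p5 :
    ∀ (W : WeierstrassCurve ℚ) [W.IsElliptic] [W.IsGloballyMinimal], W = ⟨0, 1, 1, -2, 0⟩ → W.analyticRank = 2 → ∀ (K : Type) [Field K] [NumberField K] (ι : K →+* ℂ), Literature.NumberTheory.EllipticCurves.IsImaginaryQuadratic K → NumberField.discr K = -11 → Literature.NumberTheory.EllipticCurves.SatisfiesHeegnerHypothesis (W.conductorNorm ℤ) K → (W.quadraticTwist (NumberField.discr K : ℚ)).analyticRank = 1 → ∃ (p : ℕ) (_ : Fact p.Prime), p = 5 ∧ (5 ≤ p ∧ W.HasGoodReductionAtPrime p ∧ ¬ (p : ℤ) ∣ W.frobeniusTrace p ∧ W.HasSurjectiveModNGaloisRep p ∧ ¬ (p : ℤ) ∣ NumberField.discr K ∧ ¬ p ∣ NumberField.classNumber K ∧ max W.analyticRank (W.quadraticTwist (NumberField.discr K : ℚ)).analyticRank ≤ p) ∧ (∃ (C : WeierstrassCurve.VariableChange ℚ) (_ : (C • W.quadraticTwist (NumberField.discr K : ℚ)).IsGloballyMinimal), (C • W.quadraticTwist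 (NumberField.discr K : ℚ)).HasGoodReductionAtPrime p ∧ ¬ (p : ℤ) ∣ (C • W.quadraticTwist (NumberField.discr K : ℚ)).frobeniusTrace p ∧ (C • W.quadraticTwist (NumberField.discr K : ℚ)).HasSurjectiveModNGaloisRep p) ∧ ∃ (_ : NeZero (W.conductorNorm ℤ)) (Dt : Literature.NumberTheory.EllipticCurves.ModularForms.ModularParametrizationData W (W.conductorNorm ℤ)) (β : ℤ) (y : (W.baseChange (Literature.NumberTheory.EllipticCurves.ringClassField K ι (p ^ 2))).toAffine.Point) (H : Subgroup (Literature.NumberTheory.EllipticCurves.ringClassField K ι (p ^ 2) ≃ₐ[ℚ] Literature.NumberTheory.EllipticCurves.ringClassField K ι (p ^ 2))) (σ : Literature.NumberTheory.EllipticCurves.ringClassField K ι (p ^ 2) ≃ₐ[ℚ] Literature.NumberTheory.EllipticCurves.ringClassField K ι (p ^ 2)), (4 * (W.conductorNorm ℤ : ℤ)) ∣ β ^ 2 - NumberField.discr K ∧ WeierstrassCurve.Affine.Point.map (Literature.NumberTheory.EllipticCurves.ringClassField K ι (p ^ 2)).subtype.toRatAlgHom y = Literature.NumberTheory.EllipticCurves.ModularForms.heegnerPointComplexOfConductor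 Dt (NumberField.discr K) β (p ^ 2) ∧ H ≤ Literature.NumberTheory.EllipticCurves.ringClassGal ι (p ^ 2) ∧ H.relIndex (Literature.NumberTheory.EllipticCurves.ringClassGal ι (p ^ 2)) = p ∧ (∀ g ∈ Literature.NumberTheory.EllipticCurves.ringClassGal ι (p ^ 2), ∀ h ∈ H, g * h * g⁻¹ ∈ H) ∧ σ ∈ Literature.NumberTheory.EllipticCurves.ringClassGal ι (p ^ 2) ∧ σ ∉ H ∧ ¬ ∃ (Q T : (W.baseChange (Literature.NumberTheory.EllipticCurves.ringClassField K ι (p ^ 2))).toAffine.Point), IsOfFinAddOrder T ∧ (∀ τ ∈ H, Literature.NumberTheory.EllipticCurves.pointGalHom W (Literature.NumberTheory.EllipticCurves.ringClassField K ι (p ^ 2)) τ Q = Q) ∧ (∑ i ∈ Finset.range p, Nat.choose i (max W.analyticRank (W.quadraticTwist (NumberField.discr K : ℚ)).analyticRank - 1) • Literature.NumberTheory.EllipticCurves.pointGalHom W (Literature.NumberTheory.EllipticCurves.ringClassField K ι (p ^ 2)) (σ ^ i) (∑ᶠ τ ∈ (H : Set (Literature.NumberTheory.EllipticCurves.ringClassField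 K ι (p ^ 2) ≃ₐ[ℚ] Literature.NumberTheory.EllipticCurves.ringClassField K ι (p ^ 2))), Literature.NumberTheory.EllipticCurves.pointGalHom W (Literature.NumberTheory.EllipticCurves.ringClassField K ι (p ^ 2)) τ y)) = p • Q + T := by
  sorry

namespace Statement

/-- The statement of `stub_admissiblePairCofinite`, by name (skeleton protocol: composition hypotheses are
declared stubs). -/
abbrev stub_admissiblePairCofinite : Prop := type_of% @Birth.stub_admissiblePairCofinite
/-- The statement of `stub_heegnerLift`, by name. -/
abbrev stub_heegnerLift : Prop := type_of% @Birth.stub_heegnerLift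
/-- The statement of `stub_levelOneNondivisibilityIO`, by name. -/
abbrev stub_levelOneNondivisibilityIO : Prop := type_of% @Birth.stub_levelOneNondivisibilityIO

end Statement

/-- **Composition (kernel-checked, sorry-free): stubs 1–3 give the crux `VerticalExactOrder`
(item stmt-BirchSwinnertonDyer-18466) BY NAME.**  Given `W, K, ι`: `B₁` from stub 1 at `d = d_K`; stub 3 at
`B = B₁ + 5 + |d_K| + h_K + r_an(W) + r_an(W^K)` returns a good ordinary `p ≥ B` with `(Dt, β, H, σ)` and the test
clause; such `p` is admissible (`ρ̄` onto and the twist model by stub 1; `5 ≤ p`, `p ∤ d_K`, `p ∤ h_K`, `max ≤ p`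
by size); `p ∤ N_W` (`dvd_conductorNorm_iff_not_hasGoodReductionAtPrime`), so stub 2 lifts `φ(x(p²))` to
`y ∈ E(K[p²])`, at which the test clause is the crux's conclusion. -/
theorem VerticalExactOrder_of (hA : Statement.stub_admissiblePairCofinite) (hL : Statement.stub_heegnerLift)
    (hX : Statement.stub_levelOneNondivisibilityIO) :
    Summit.BirchSwinnertonDyer.BirchSwinnertonDyer.Theses.VerticalHeegnerOrder.VerticalExactOrder := by
  intro W _ _ hCM h2 K _ _ ι hKq hHeeg hdisc hbal
  have hd0 : NumberField.discr K ≠ 0 := NumberField.discr_ne_zero K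
  -- stub 1: cofinite admissibility threshold for the pair (W, W^{d_K})
  obtain ⟨B₁, hB₁⟩ := hA W hCM (NumberField.discr K) hd0
  -- stub 3: a good ordinary prime beyond every bookkeeping threshold, with the Heegner data and the test clause
  obtain ⟨p, hp, hBp, hgood, hord, hN, Dt, β, H, σ, hβ, hHle, hidx, hnorm, hσ, hσH, htest⟩ :=
    hX W hCM h2 K ι hKq hHeeg hdisc hbal
      (B₁ + 5 + (NumberField.discr K).natAbs + NumberField.classNumber K + W.analyticRank +
        (W.quadraticTwist (NumberField.discr K : ℚ)).analyticRank)
  -- admissibility of `p`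
  obtain ⟨hsurj, C, hmin, hgoodC, hordC, hsurjC⟩ := hB₁ p (by omega) hgood hord
  have h5 : 5 ≤ p := by omega
  have hpd : ¬ (p : ℤ) ∣ NumberField.discr K := by
    intro h
    have h1 : p ≤ (NumberField.discr K).natAbs :=
      Nat.le_of_dvd (Int.natAbs_pos.mpr hd0) (Int.natCast_dvd.mp h)
    omega
  have hh : 0 < NumberField.classNumber K := by
    unfold NumberField.classNumber
    exact Fintype.card_pos_iff.mpr ⟨1⟩
  have hph : ¬ p ∣ NumberField.classNumber K := by
    intro h
    have h1 : p ≤ NumberField.classNumber K := Nat.le_of_dvd hh h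
    omega
  have hmax : max W.analyticRank (W.quadraticTwist (NumberField.discr K : ℚ)).analyticRank ≤ p :=
    max_le (by omega) (by omega)
  -- stub 2: the lift `y ∈ E(K[p²])` of `φ(x(p²))` (`p ∤ N_W` from good reduction)
  have hpN : ¬ p ∣ W.conductorNorm ℤ := fun h ↦
    (W.dvd_conductorNorm_iff_not_hasGoodReductionAtPrime p).mp h hgood
  have hcop : Nat.Coprime (p ^ 2) (W.conductorNorm ℤ) :=
    Nat.Coprime.pow_left 2 ((Nat.Prime.coprime_iff_not_dvd hp.out).mpr hpN)
  obtain ⟨y, hy⟩ := hL W K ι hKq hHeeg Dt β hβ (p ^ 2) (pow_ne_zero 2 hp.out.ne_zero) hcop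
  exact ⟨p, hp, ⟨h5, hgood, hord, hsurj, hpd, hph, hmax⟩, ⟨C, hmin, hgoodC, hordC, hsurjC⟩, hN, Dt, β, y, H,
    σ, hβ, hy, hHle, hidx, hnorm, hσ, hσH, htest y hy⟩

end Summit.BirchSwinnertonDyer.BirchSwinnertonDyer.Cruxes.VerticalExactOrder.Birth
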